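import Mathlib.Algebra.Algebra.Basic
import Mathlib.Algebra.Module.LinearMap.End
import Mathlib.Data.Complex.Basic
import Mathlib.Tactic.NoncommRing
import Mathlib.Tactic.LinearCombination
import Mathlib.Tactic.Module
import HarnessLib

/-!
# Two commuting `𝔰𝔩₂`-triples: the step-down vector of a primitive vector for the diagonal triple

Topic `Algebra/Lie` (next to `Sl2Strings`, `CasimirElement`); theorems only (no definition, no structure,
no named fact). This is the pure algebra behind the integral pairing of Harish-Chandra parameters at a
complex place (Naimark's relation at the bottom `K`-type of a Harish-Chandra module of `SL₂(ℂ)`: Naimark,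
*Linear representations of the Lorentz group* (1964), Ch. III §11; the resulting classification of the
irreducible representations of `SL₂(ℂ)` is e.g. in Knapp, *Representation Theory of Semisimple Groups*
(1986), Ch. II §4), in the following abstract form. Let a complex vector space
`V` carry two COMMUTING `𝔰𝔩₂`-triples of operators `(e, f, h)` and `(e', f', h')` (`he - eh = 2e`,
`hf - fh = -2f`, `ef - fe = h`, primed likewise, every unprimed operator commuting with every primed one)
whose (normal-ordered, rescaled) Casimir operators act by scalars,
`4fe + 2h + h² = 2ω`, `4f'e' + 2h' + h'² = 2ω'`. Write `E = e + e'`, `F = f + f'`, `H = h + h'` (the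
diagonal triple) and `p = e - e'`, `q = f - f'`, `r = h - h'`. For a vector `v` with `E v = 0`,
`H v = m v` put

`z = m² q v - (m/2) r (F v) - (ω - ω') F v`   (the step-down vector).

Then (`stepDown_E`, `stepDown_H`, `stepDown_p`)

`E z = 0`, `H z = (m - 2) z`, `p z = (m² (ω + ω' + 1) - m⁴/4 - (ω - ω')²) v`,

and with `2ω = a² - 1`, `2ω' = b² - 1` the last scalar is `-¼ (m² - (a+b)²)(m² - (a-b)²)`
(`stepDown_scalar_eq`). In the application (`𝔤𝔩₂(ℂ) ⊗_ℝ ℂ ≅ 𝔤𝔩₂(ℂ) × 𝔤𝔩₂(ℂ)` acting on a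
`(𝔤, K)`-module, `K = U(2)`) the diagonal triple is the complexified action of `𝔰𝔲(2)`, `v` a primitive
vector of MINIMAL weight `m`, so `z = 0` and the scalar vanishes: `a ± b = ± m` is an integer of the
parity of the central weight — the integral pairing of the two Harish-Chandra parameters.

Everything here is elementary manipulation of the commutation relations; hypotheses are passed
explicitly, each lemma taking the ones it uses. Mathlib has `IsSl2Triple` (one triple, Lie-module form)
but nothing on pairs of commuting triples or their diagonal (`lean search 'sl2.*pair|commuting.*triple'`).

## References

* M. A. Naimark, *Linear representations of the Lorentz group*, Pergamon 1964, Ch. III §11.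
* A. W. Knapp, *Representation Theory of Semisimple Groups* (1986), Ch. II §4. [Knapp1986]
-/

noncomputable section

namespace Literature.Algebra.Lie.Sl2Pair

variable {V : Type*} [AddCommGroup V] [Module ℂ V]
variable {e f h e' f' h' : Module.End ℂ V} {ω ω' : ℂ}

/-! ### Ring identities for the diagonal triple `E, F, H` and `p, q, r` -/

/-- `[E, q] = r` for two commuting triples. [folklore] -/
theorem E_q (hef : e * f - f * e = h) (hef' : e' * f' - f' * e' = h')
    (cef : e * f' = f' * e) (cfe : f * e' = e' * f) :
    (e + e') * (f - f') - (f - f') * (e + e') = h - h' := by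
  have : (e + e') * (f - f') - (f - f') * (e + e') =
      (e * f - f * e) - (e * f' - f' * e) + (e' * f - f * e') - (e' * f' - f' * e') := by noncomm_ring
  rw [this, hef, hef', cef, cfe, sub_self, sub_self]; abel

/-- `[E, r] = -2p` for two commuting triples. [folklore] -/
theorem E_r (hhe : h * e - e * h = 2 * e) (hhe' : h' * e' - e' * h' = 2 * e')
    (ceh : e * h' = h' * e) (che : h * e' = e' * h) :
    (e + e') * (h - h') - (h - h') * (e + e') = -(2 * (e - e')) := by
  have : (e + e') * (h - h') - (h - h') * (e + e') =
      -(h * e - e * h) - (e * h' - h' * e) - (h * e' - e' * h) + (h' * e' - e' * h') := by noncomm_ring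
  rw [this, hhe, hhe', ceh, che, sub_self, sub_self]; noncomm_ring

/-- `[E, F] = H` for two commuting triples. [folklore] -/
theorem E_F (hef : e * f - f * e = h) (hef' : e' * f' - f' * e' = h')
    (cef : e * f' = f' * e) (cfe : f * e' = e' * f) :
    (e + e') * (f + f') - (f + f') * (e + e') = h + h' := by
  have : (e + e') * (f + f') - (f + f') * (e + e') =
      (e * f - f * e) + (e * f' - f' * e) - (f * e' - e' * f) + (e' * f' - f' * e') := by noncomm_ring
  rw [this, hef, hef', cef, cfe, sub_self, sub_self]; abel

/-- `[p, F] = r` for two commuting triples. [folklore] -/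
theorem p_F (hef : e * f - f * e = h) (hef' : e' * f' - f' * e' = h')
    (cef : e * f' = f' * e) (cfe : f * e' = e' * f) :
    (e - e') * (f + f') - (f + f') * (e - e') = h - h' := by
  have : (e - e') * (f + f') - (f + f') * (e - e') =
      (e * f - f * e) + (e * f' - f' * e) + (f * e' - e' * f) - (e' * f' - f' * e') := by noncomm_ring
  rw [this, hef, hef', cef, cfe, sub_self, sub_self]; abel

/-- `[p, q] = H` for two commuting triples. [folklore] -/
theorem p_q (hef : e * f - f * e = h) (hef' : e' * f' - f' * e' = h')
    (cef : e * f' = f' * e) (cfe : f * e' = e' * f) :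
    (e - e') * (f - f') - (f - f') * (e - e') = h + h' := by
  have : (e - e') * (f - f') - (f - f') * (e - e') =
      (e * f - f * e) - (e * f' - f' * e) + (f * e' - e' * f) + (e' * f' - f' * e') := by noncomm_ring
  rw [this, hef, hef', cef, cfe, sub_self, sub_self]; abel

/-- `[p, r] = -2E` for two commuting triples. [folklore] -/
theorem p_r (hhe : h * e - e * h = 2 * e) (hhe' : h' * e' - e' * h' = 2 * e')
    (ceh : e * h' = h' * e) (che : h * e' = e' * h) :
    (e - e') * (h - h') - (h - h') * (e - e') = -(2 * (e + e')) := by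
  have : (e - e') * (h - h') - (h - h') * (e - e') =
      -(h * e - e * h) - (e * h' - h' * e) + (h * e' - e' * h) - (h' * e' - e' * h') := by noncomm_ring
  rw [this, hhe, hhe', ceh, che, sub_self]; noncomm_ring

/-- `[H, q] = -2q` for two commuting triples. [folklore] -/
theorem H_q (hhf : h * f - f * h = -(2 * f)) (hhf' : h' * f' - f' * h' = -(2 * f'))
    (chf : h * f' = f' * h) (cfh : f * h' = h' * f) :
    (h + h') * (f - f') - (f - f') * (h + h') = -(2 * (f - f')) := by
  have : (h + h') * (f - f') - (f - f') * (h + h') =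
      (h * f - f * h) - (h * f' - f' * h) - (f * h' - h' * f) - (h' * f' - f' * h') := by noncomm_ring
  rw [this, hhf, hhf', chf, cfh, sub_self]; noncomm_ring

/-- `[H, r] = 0` for two commuting triples. [folklore] -/
theorem H_r (chh : h * h' = h' * h) : (h + h') * (h - h') = (h - h') * (h + h') := by
  have : (h + h') * (h - h') - (h - h') * (h + h') = -(2 * (h * h' - h' * h)) := by noncomm_ring
  rw [chh, sub_self, mul_zero, neg_zero] at this
  exact sub_eq_zero.mp this

/-- `[H, F] = -2F` for two commuting triples. [folklore] -/
theorem H_F (hhf : h * f - f * h = -(2 * f)) (hhf' : h' * f' - f' * h' = -(2 * f'))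
    (chf : h * f' = f' * h) (cfh : f * h' = h' * f) :
    (h + h') * (f + f') - (f + f') * (h + h') = -(2 * (f + f')) := by
  have : (h + h') * (f + f') - (f + f') * (h + h') =
      (h * f - f * h) + (h * f' - f' * h) - (f * h' - h' * f) + (h' * f' - f' * h') := by noncomm_ring
  rw [this, hhf, hhf', chf, cfh, sub_self]; noncomm_ring

/-- The SUM of the two Casimir relations in diagonal variables:
`4FE + 4qp + 4H + (H² + r²) = 4(ω + ω')` (a free identity plus the two Casimir relations). [folklore] -/
theorem casimir_add (hc : 4 * (f * e) + 2 * h + h * h = (2 * ω) • (1 : Module.End ℂ V))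
    (hc' : 4 * (f' * e') + 2 * h' + h' * h' = (2 * ω') • (1 : Module.End ℂ V)) :
    4 * ((f + f') * (e + e')) + 4 * ((f - f') * (e - e')) + 4 * (h + h') +
        ((h + h') * (h + h') + (h - h') * (h - h')) =
      (4 * (ω + ω')) • (1 : Module.End ℂ V) := by
  have : 4 * ((f + f') * (e + e')) + 4 * ((f - f') * (e - e')) + 4 * (h + h') +
        ((h + h') * (h + h') + (h - h') * (h - h')) =
      2 * (4 * (f * e) + 2 * h + h * h) + 2 * (4 * (f' * e') + 2 * h' + h' * h') := by noncomm_ring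
  have h2 : (2 : Module.End ℂ V) = (2 : ℂ) • (1 : Module.End ℂ V) := by
    rw [← map_ofNat (algebraMap ℂ (Module.End ℂ V)) 2, Algebra.algebraMap_eq_smul_one]
  rw [this, hc, hc', mul_smul_comm, mul_smul_comm, mul_one, ← add_smul, h2, smul_smul]
  congr 1; ring

/-- The DIFFERENCE of the two Casimir relations in diagonal variables:
`2Fp + 2qE + 2r + Hr = 2(ω - ω')` (uses `hh' = h'h`). [folklore] -/
theorem casimir_sub (chh : h * h' = h' * h)
    (hc : 4 * (f * e) + 2 * h + h * h = (2 * ω) • (1 : Module.End ℂ V))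
    (hc' : 4 * (f' * e') + 2 * h' + h' * h' = (2 * ω') • (1 : Module.End ℂ V)) :
    2 * ((f + f') * (e - e')) + 2 * ((f - f') * (e + e')) + 2 * (h - h') + (h + h') * (h - h') =
      (2 * (ω - ω')) • (1 : Module.End ℂ V) := by
  have : 2 * ((f + f') * (e - e')) + 2 * ((f - f') * (e + e')) + 2 * (h - h') + (h + h') * (h - h') =
      (4 * (f * e) + 2 * h + h * h) - (4 * (f' * e') + 2 * h' + h' * h') - (h * h' - h' * h) := by
    noncomm_ring
  rw [this, hc, hc', chh, sub_self, sub_zero, ← sub_smul]; congr 1; ring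

/-! ### The step-down vector -/

/-- Numerals of `End V` act as natural-number scalars, here rewritten as complex scalars:
`(2 X) v = (2 : ℂ) • X v`. [folklore] -/
theorem two_mul_apply (X : Module.End ℂ V) (v : V) : (2 * X) v = (2 : ℂ) • X v := by
  rw [Module.End.mul_apply, Module.End.ofNat_apply]
  exact (ofNat_smul_eq_nsmul ℂ _ _).symm

/-- `(4 X) v = (4 : ℂ) • X v`. [folklore] -/
theorem four_mul_apply (X : Module.End ℂ V) (v : V) : (4 * X) v = (4 : ℂ) • X v := by
  rw [Module.End.mul_apply, Module.End.ofNat_apply]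
  exact (ofNat_smul_eq_nsmul ℂ _ _).symm

/-- **The step-down vector.** For two commuting `𝔰𝔩₂`-triples `(e, f, h)`, `(e', f', h')` of operators on
`V` with scalar Casimir operators `4fe + 2h + h² = 2ω`, `4f'e' + 2h' + h'² = 2ω'`, and a vector `v`
killed by `E = e + e'` on which `H = h + h'` acts by `m`, the vector
`z = m² (f - f') v - (m/2) (h - h') ((f + f') v) - (ω - ω') (f + f') v` is killed by `E`, is an
`H`-eigenvector of eigenvalue `m - 2`, and `(e - e') z = (m² (ω + ω' + 1) - m⁴/4 - (ω - ω')²) v`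
(Naimark's relation between the raising/lowering matrix elements of the boost operators between
adjacent `K`-types of a Harish-Chandra module of `SL₂(ℂ)` and its two Casimir operators, at the level
of highest weight vectors; Naimark 1964, Ch. III §11). [folklore] -/
theorem stepDown
    (hhe : h * e - e * h = 2 * e) (hhf : h * f - f * h = -(2 * f)) (hef : e * f - f * e = h)
    (hhe' : h' * e' - e' * h' = 2 * e') (hhf' : h' * f' - f' * h' = -(2 * f'))
    (hef' : e' * f' - f' * e' = h')
    (cef : e * f' = f' * e) (ceh : e * h' = h' * e) (cfe : f * e' = e' * f)
    (cfh : f * h' = h' * f) (che : h * e' = e' * h) (chf : h * f' = f' * h) (chh : h * h' = h' * h)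
    (hc : 4 * (f * e) + 2 * h + h * h = (2 * ω) • (1 : Module.End ℂ V))
    (hc' : 4 * (f' * e') + 2 * h' + h' * h' = (2 * ω') • (1 : Module.End ℂ V))
    {m : ℂ} {v : V} (hEv : (e + e') v = 0) (hHv : (h + h') v = m • v) :
    (e + e') (m ^ 2 • (f - f') v - (m / 2) • (h - h') ((f + f') v) - (ω - ω') • (f + f') v) = 0 ∧
    (h + h') (m ^ 2 • (f - f') v - (m / 2) • (h - h') ((f + f') v) - (ω - ω') • (f + f') v) =
      (m - 2) • (m ^ 2 • (f - f') v - (m / 2) • (h - h') ((f + f') v) - (ω - ω') • (f + f') v) ∧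
    (e - e') (m ^ 2 • (f - f') v - (m / 2) • (h - h') ((f + f') v) - (ω - ω') • (f + f') v) =
      (m ^ 2 * (ω + ω' + 1) - m ^ 4 / 4 - (ω - ω') ^ 2) • v := by
  -- vector forms of the ring identities
  have hHHv : (h + h') ((h + h') v) = (m * m) • v := by rw [hHv, map_smul, hHv, smul_smul]
  -- (v1) `E (q v) = r v`
  have v1 : (e + e') ((f - f') v) = (h - h') v := by
    have t : (e + e') ((f - f') v) - (f - f') ((e + e') v) = (h - h') v :=
      LinearMap.congr_fun (E_q hef hef' cef cfe) v
    rwa [hEv, map_zero, sub_zero] at t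
  -- (v5) `E (F v) = m v`
  have v5 : (e + e') ((f + f') v) = m • v := by
    have t : (e + e') ((f + f') v) - (f + f') ((e + e') v) = (h + h') v :=
      LinearMap.congr_fun (E_F hef hef' cef cfe) v
    rwa [hEv, map_zero, sub_zero, hHv] at t
  -- `H (r v) = m • r v`
  have hHr : (h + h') ((h - h') v) = m • (h - h') v := by
    have t : (h + h') ((h - h') v) = (h - h') ((h + h') v) := LinearMap.congr_fun (H_r chh) v
    rw [t, hHv, map_smul]
  -- (v2) `F (p v) = δ v - (1 + m/2) r v` and `p (F v) = δ v - (m/2) r v`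
  have vFp : (f + f') ((e - e') v) = (ω - ω') • v - (1 + m / 2) • (h - h') v := by
    have t : (2 : ℂ) • (f + f') ((e - e') v) + (2 : ℂ) • (f - f') ((e + e') v) +
        (2 : ℂ) • (h - h') v + (h + h') ((h - h') v) = (2 * (ω - ω')) • v := by
      have t0 := LinearMap.congr_fun (casimir_sub chh hc hc') v
      simp only [LinearMap.add_apply, two_mul_apply, LinearMap.smul_apply, Module.End.one_apply] at t0
      exact t0
    rw [hEv, map_zero, smul_zero, add_zero, hHr] at t
    linear_combination (norm := module) ((1 : ℂ) / 2) • t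
  have v2 : (e - e') ((f + f') v) = (ω - ω') • v - (m / 2) • (h - h') v := by
    have t : (e - e') ((f + f') v) - (f + f') ((e - e') v) = (h - h') v :=
      LinearMap.congr_fun (p_F hef hef' cef cfe) v
    rw [vFp] at t
    linear_combination (norm := module) t
  -- (v3) `r (r v) = (4σ - 4m - m²) v - 4 q (p v)`
  have v3 : (h - h') ((h - h') v) =
      (4 * (ω + ω') - 4 * m - m * m) • v - (4 : ℂ) • (f - f') ((e - e') v) := by
    have t : (4 : ℂ) • (f + f') ((e + e') v) + (4 : ℂ) • (f - f') ((e - e') v) + (4 : ℂ) • (h + h') v +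
        ((h + h') ((h + h') v) + (h - h') ((h - h') v)) = (4 * (ω + ω')) • v := by
      have t0 := LinearMap.congr_fun (casimir_add hc hc') v
      simp only [LinearMap.add_apply, four_mul_apply, LinearMap.smul_apply, Module.End.one_apply] at t0
      exact t0
    rw [hEv, map_zero, smul_zero, zero_add, hHHv, hHv] at t
    linear_combination (norm := module) t
  -- (v4) `p (q v) = q (p v) + m v`
  have v4 : (e - e') ((f - f') v) = (f - f') ((e - e') v) + m • v := by
    have t : (e - e') ((f - f') v) - (f - f') ((e - e') v) = (h + h') v :=
      LinearMap.congr_fun (p_q hef hef' cef cfe) v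
    rw [hHv] at t
    linear_combination (norm := module) t
  -- (v6) `p (r (F v)) = δ r v - (m/2) r (r v) - 2 m v`
  have v6 : (e - e') ((h - h') ((f + f') v)) =
      (ω - ω') • (h - h') v - (m / 2) • (h - h') ((h - h') v) - (2 * m) • v := by
    have t : (e - e') ((h - h') ((f + f') v)) - (h - h') ((e - e') ((f + f') v)) =
        -((2 * (e + e')) ((f + f') v)) := LinearMap.congr_fun (p_r hhe hhe' ceh che) ((f + f') v)
    rw [two_mul_apply, v2, v5, map_sub, map_smul, map_smul] at t
    linear_combination (norm := module) t
  -- (v7) `E (r (F v)) = 2 m r v - 2 δ v`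
  have v7 : (e + e') ((h - h') ((f + f') v)) = (2 * m) • (h - h') v - (2 * (ω - ω')) • v := by
    have t : (e + e') ((h - h') ((f + f') v)) - (h - h') ((e + e') ((f + f') v)) =
        -((2 * (e - e')) ((f + f') v)) := LinearMap.congr_fun (E_r hhe hhe' ceh che) ((f + f') v)
    rw [two_mul_apply, v2, v5, map_smul] at t
    linear_combination (norm := module) t
  -- (v8) weights: `H (q v) = (m-2) q v`, `H (F v) = (m-2) F v`, `H (r (F v)) = (m-2) r (F v)`
  have v8q : (h + h') ((f - f') v) = (m - 2) • (f - f') v := by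
    have t : (h + h') ((f - f') v) - (f - f') ((h + h') v) = -((2 * (f - f')) v) :=
      LinearMap.congr_fun (H_q hhf hhf' chf cfh) v
    rw [two_mul_apply, hHv, map_smul] at t
    linear_combination (norm := module) t
  have v8F : (h + h') ((f + f') v) = (m - 2) • (f + f') v := by
    have t : (h + h') ((f + f') v) - (f + f') ((h + h') v) = -((2 * (f + f')) v) :=
      LinearMap.congr_fun (H_F hhf hhf' chf cfh) v
    rw [two_mul_apply, hHv, map_smul] at t
    linear_combination (norm := module) t
  have v8r : (h + h') ((h - h') ((f + f') v)) = (m - 2) • (h - h') ((f + f') v) := by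
    have t : (h + h') ((h - h') ((f + f') v)) = (h - h') ((h + h') ((f + f') v)) :=
      LinearMap.congr_fun (H_r chh) ((f + f') v)
    rw [t, v8F, map_smul]
  refine ⟨?_, ?_, ?_⟩
  · -- `E z = 0`
    rw [map_sub, map_sub, map_smul, map_smul, map_smul, v1, v7, v5]
    module
  · -- `H z = (m - 2) z`
    rw [map_sub, map_sub, map_smul, map_smul, map_smul, v8q, v8r, v8F]
    module
  · -- `p z = Φ v`
    rw [map_sub, map_sub, map_smul, map_smul, map_smul, v4, v6, v2, v3]
    module

/-- The step-down scalar factors: with `2ω = a² - 1`, `2ω' = b² - 1`,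
`m² (ω + ω' + 1) - m⁴/4 - (ω - ω')² = -¼ (m² - (a + b)²) (m² - (a - b)²)`. [folklore] -/
theorem stepDown_scalar_eq {a b m : ℂ} (hω : 2 * ω = a ^ 2 - 1) (hω' : 2 * ω' = b ^ 2 - 1) :
    m ^ 2 * (ω + ω' + 1) - m ^ 4 / 4 - (ω - ω') ^ 2 =
      -(1 / 4) * ((m ^ 2 - (a + b) ^ 2) * (m ^ 2 - (a - b) ^ 2)) := by
  have h1 : ω = (a ^ 2 - 1) / 2 := by linear_combination hω / 2
  have h2 : ω' = (b ^ 2 - 1) / 2 := by linear_combination hω' / 2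
  rw [h1, h2]; ring

end Literature.Algebra.Lie.Sl2Pair

end
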